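import Literature.AlgebraicGeometry.HodgeTheory.GlobalInvariantCycles
import Literature.AlgebraicGeometry.HodgeTheory.IsoTransport
import HarnessLib

/-!
# Good families and absolutely rigid Hodge classes (real carriers)

Definition request `defn-IsAbsolutelyRigidHodgeClass` (route `HodgeConjecture/PadicSemiregularLift`,
crux `HodgeBeyondAnchors`, line `andre_variational`: the variational trichotomy of "Hodge classes are
motivated"). Two PREDICATES, no facts, on the real carriers of `HodgeLocus.lean` (fibre classes
`FiberClass f (2p)` with the étalé topology of `R²ᵖ f_* ℂ`, the locus of Hodge classes
`locusOfHodgeClasses f n p` and its connected components `HodgeLocusComponent f n p`):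

* `GoodFamily n f`: `f : 𝒳 ⟶ S` is a smooth projective family of relative dimension `n`
  (`Motives.IsSmoothProjectiveFamily f n`) over a smooth (`Smooth S.hom`) quasi-projective
  (`IsQuasiProjectiveOver S`) complex base — exactly the hypotheses on the family in the tree's named
  facts `deligne_globalInvariantCycles` (Deligne, *Hodge II*, Thm. 4.1.1; Charles–Schnell Thm. 11.3.4)
  and `charlesSchnell_hodgeClass_of_flat`, and the setting of Cattani–Deligne–Kaplan, §1 ("`S` a
  nonsingular complex algebraic variety", "`f : X → S`, with `X` projective and smooth over `S`").
* `IsAbsolutelyRigidHodgeClass n X p c`, for a class `c ∈ H²ᵖ(X(ℂ); ℂ)`: in EVERY good family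
  `f : 𝒳 ⟶ S` and for every identification `e : 𝒳_t ≅ X` of a fibre with `X` under which `e^* c` is a
  Hodge class (rational of type `(p, p)`) on `𝒳_t`, every fibre class `(s, β)` in the connected
  component of the locus of Hodge classes through `(t, e^* c)` lies over a fibre `𝒳_s ≅ X`.
  Equivalently (`isAbsolutelyRigidHodgeClass_iff_base_subset`): the HODGE LOCUS of `e^* c` — "the
  image in `T` of the connected component of the locus of Hodge classes passing through `α`"
  (Voisin 2007, §1) — is contained in `{s | 𝒳_s ≅ X}`: the class `c` remains of Hodge type `(p, p)`
  along no deformation of `X` to a non-isomorphic variety. This is the global, component-wise form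
  of "an isolated point in the Hodge locus" (Voisin 2007, §0), insensitive to isotrivial directions;
  to first order it is governed by the Zariski tangent space `T_{U_λ^p, x} = Ker ∇̄_x(λ̄_x)` of the
  Hodge locus (Voisin II, Lemma 5.16; abstractly `InfinitesimalInjectivityAt` in
  `HodgeLociInfinitesimal.lean`), i.e. by the contraction `H¹(T_X) → H^{p-1,p+1}(X)`, `θ ↦ θ ⌟ c^{p,p}`
  on the embedded deformations. The adjective "absolutely rigid" is the requesting route's name for
  this predicate (it is not terminology of the sources, which provide its ingredients).

API (all proved): projections of `GoodFamily`; `isAbsolutelyRigidHodgeClass_iff_base_subset` and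
`IsAbsolutelyRigidHodgeClass.hodgeLocusOfClass_subset` (Hodge-locus form);
`not_isAbsolutelyRigidHodgeClass_iff` (the shape consumed by the trichotomy: a good family moving
`(t, e^* c)` inside its component to a non-isomorphic fibre); invariance under isomorphisms `X' ≅ X`
(`isAbsolutelyRigidHodgeClass_map_iff_of_iso`, from `IsoTransport.lean`); and the degenerate case
`isAbsolutelyRigidHodgeClass_of_not_isRationalClass` documenting the boundary of the definition.

## Design and junk cases

* The component is taken in the étalé topology of `HodgeLocus.lean` (see its module docstring,
  "Why no `Motives.LocalSystem`": inside the locus these are the components of Voisin / Charles–Schnell).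
* The predicate is a `∀` over families, identifications and a membership hypothesis `hx`; when these
  are never met it holds VACUOUSLY: if `c` is not a rational class (then no `e^* c` is,
  `isRationalClass_map_iff_of_iso`) — recorded as `isAbsolutelyRigidHodgeClass_of_not_isRationalClass` —
  and likewise if `c` is not of Hodge type `(p, p)` or `X` is not smooth projective of dimension `n`
  (no good family has a fibre isomorphic to `X`). The requesting route only applies it to rational
  `(p, p)`-classes on smooth projective `X` (`2 ≤ p`, `2p ≤ n`).
* Nothing here asserts that absolutely rigid classes exist or that any given class is one: deciding
  it for a single pair `(X, c)` is a statement about all deformations of `X`.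

## What is NOT here

No facts: Cattani–Deligne–Kaplan's algebraicity/finiteness of the components (Thm. 1.1, Cor. 1.2),
the first-order criterion (Voisin II, Lemma 5.16 / Cor. 5.18 on real families) and André's
deformation theorem along components are separate items of the requesting line.

## References

* [Voisin2007HodgeLoci] C. Voisin, *Hodge loci and absolute Hodge classes*, Compositio Math. 143
  (2007), §0 ("isolated point in the Hodge locus") and §1 (locus of Hodge classes, components of the
  Hodge locus, Hodge locus of `α`); arXiv math/0605766 §1–§2.
* [CattaniDeligneKaplan1995JAMS] E. Cattani, P. Deligne, A. Kaplan, *On the locus of Hodge classes*,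
  JAMS 8 (1995), §1 (setting; "the locus `T ⊂ U` where `h` remains of type `(p,p)`"; Thm. 1.1,
  Cor. 1.2).
* [VoisinHodgeII2003] C. Voisin, *Hodge Theory and Complex Algebraic Geometry II*, §5.3.1 Def. 5.12,
  §5.3.2 Lemma 5.16.
* [CharlesSchnell2014Notes] F. Charles, C. Schnell, *Notes on absolute Hodge classes*, Thm. 11.3.4,
  Prop. 11.3.5 (hypotheses of a good family).
-/

noncomputable section

open CategoryTheory AlgebraicGeometry
open Literature.AlgebraicTopology.SingularHomology

namespace Literature.AlgebraicGeometry.HodgeTheory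

section HodgeTheory

/-! ### Good families -/

section GoodFamilies

variable {𝒳 S : Motives.SchemeOver ℂ}

/-- A **good family** of relative dimension `n`: a smooth projective family `f : 𝒳 ⟶ S` of relative
dimension `n` (`Motives.IsSmoothProjectiveFamily f n`: smooth of relative dimension `n`, proper,
with smooth projective `n`-dimensional fibres) over a smooth quasi-projective complex base `S`
(`IsQuasiProjectiveOver S ∧ Smooth S.hom`) — the hypotheses on the family of the tree's
`deligne_globalInvariantCycles` / `charlesSchnell_hodgeClass_of_flat` ("Let `π : 𝒳 → S` be a smooth
projective morphism of quasi-projective complex varieties", `S` smooth) and the setting of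
Cattani–Deligne–Kaplan ("`S` a nonsingular complex algebraic variety … `f : X → S`, with `X`
projective and smooth over `S`"). [cite: CattaniDeligneKaplan1995JAMS, §1]
[cite: CharlesSchnell2014Notes, Theorem 11.3.4 and Proposition 11.3.5] -/
def GoodFamily (n : ℕ) {𝒳 S : Motives.SchemeOver ℂ} (f : 𝒳 ⟶ S) : Prop :=
  Motives.IsSmoothProjectiveFamily f n ∧ IsQuasiProjectiveOver S ∧ Smooth S.hom

namespace GoodFamily

variable {n : ℕ} {f : 𝒳 ⟶ S}

/-- A good family is a smooth projective family of relative dimension `n`. [cite: CattaniDeligneKaplan1995JAMS, §1] -/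
theorem isSmoothProjectiveFamily (hf : GoodFamily n f) : Motives.IsSmoothProjectiveFamily f n :=
  hf.1

/-- The base of a good family is quasi-projective over `ℂ`. [cite: CattaniDeligneKaplan1995JAMS, §1] -/
theorem isQuasiProjectiveOver (hf : GoodFamily n f) : IsQuasiProjectiveOver S :=
  hf.2.1

/-- The base of a good family is smooth over `ℂ` ("`S` nonsingular"). [cite: CattaniDeligneKaplan1995JAMS, §1] -/
theorem smooth (hf : GoodFamily n f) : Smooth S.hom :=
  hf.2.2

/-- Every fibre `𝒳_t`, `t ∈ S(ℂ)`, of a good family is a smooth projective variety of dimension `n`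
("the `X_s` are non singular projective varieties"). [cite: CattaniDeligneKaplan1995JAMS, §1] -/
theorem isSmoothProjective_fiberOver (hf : GoodFamily n f) (t : Motives.ComplexPoints S) :
    Motives.IsSmoothProjective n (Motives.fiberOver f t) :=
  hf.1.isSmoothProjective t

end GoodFamily

/-- The hypotheses of `deligne_globalInvariantCycles` / `charlesSchnell_hodgeClass_of_flat` on the
family, bundled: `GoodFamily n f ↔ IsSmoothProjectiveFamily f n ∧ IsQuasiProjectiveOver S ∧ Smooth S.hom`
(by definition). [cite: CharlesSchnell2014Notes, Theorem 11.3.4] -/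
theorem goodFamily_iff {n : ℕ} {f : 𝒳 ⟶ S} :
    GoodFamily n f ↔ Motives.IsSmoothProjectiveFamily f n ∧ IsQuasiProjectiveOver S ∧ Smooth S.hom :=
  Iff.rfl

end GoodFamilies

/-! ### Components of the locus of Hodge classes through equal points -/

section Components

variable {𝒳 S : Motives.SchemeOver ℂ} {f : 𝒳 ⟶ S} {n p : ℕ}

/-- The component of the locus of Hodge classes through a Hodge class only depends on the class
(proof-irrelevant bookkeeping for the dependent pair `(x, hx)`). [folklore] -/
theorem HodgeLocusComponent.of_congr {x x' : FiberClass f (2 * p)}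
    (hx : x ∈ locusOfHodgeClasses f n p) (hx' : x' ∈ locusOfHodgeClasses f n p) (h : x = x') :
    HodgeLocusComponent.of x hx = HodgeLocusComponent.of x' hx' := by
  subst h
  rfl

end Components

/-! ### Absolutely rigid Hodge classes -/

section Rigid

variable (n : ℕ) (X : Motives.SchemeOver ℂ) (p : ℕ)

/-- The class `c ∈ H²ᵖ(X(ℂ); ℂ)` is an **absolutely rigid Hodge class** on `X` (intended: `X` smooth
projective of dimension `n`, `c` rational of Hodge type `(p, p)`): for every good family
`f : 𝒳 ⟶ S` (smooth projective of relative dimension `n` over a smooth quasi-projective base), every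
`t ∈ S(ℂ)` and every identification `e : 𝒳_t ≅ X` under which `e^* c` is a Hodge class on `𝒳_t`
(`(t, e^* c) ∈ locusOfHodgeClasses f n p`), every fibre class `y = (s, β)` in the connected component
of the locus of Hodge classes through `(t, e^* c)` lies over a fibre `𝒳_s` isomorphic to `X`.
Equivalently the Hodge locus of `e^* c` ("the image in `T` of the connected component of the locus of
Hodge classes passing through `α`", Voisin 2007, §1) is contained in `{s | 𝒳_s ≅ X}`
(`isAbsolutelyRigidHodgeClass_iff_base_subset`): `c` remains of type `(p, p)` ("the locus `T ⊂ U`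
where `h` remains of type `(p,p)`", Cattani–Deligne–Kaplan §1) along NO deformation of `X` to a
non-isomorphic variety — the component-wise form of "an isolated point in the Hodge locus"
(Voisin 2007, §0), governed to first order by `T_{U_λ^p,x} = Ker ∇̄_x(λ̄_x)` (Voisin II, Lemma 5.16).
The name "absolutely rigid" is the requesting route's (line `andre_variational` of crux
`HodgeBeyondAnchors`); the sources supply the ingredients. Holds vacuously when `c` is not a rational
`(p, p)`-class or `X` is not smooth projective of dimension `n` (see the module docstring).
[cite: Voisin2007HodgeLoci, §0–§1 (arXiv math/0605766: §1–§2)] [cite: CattaniDeligneKaplan1995JAMS, §1] -/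
def IsAbsolutelyRigidHodgeClass (c : complexBetti X (2 * p)) : Prop :=
  ∀ ⦃𝒳 S : Motives.SchemeOver ℂ⦄ (f : 𝒳 ⟶ S), GoodFamily n f →
    ∀ (t : Motives.ComplexPoints S) (e : Motives.fiberOver f t ≅ X)
      (hx : (⟨t, complexBetti.map e.hom (2 * p) c⟩ : FiberClass f (2 * p)) ∈
        locusOfHodgeClasses f n p),
      ∀ y ∈ (HodgeLocusComponent.of _ hx).carrier, Nonempty (Motives.fiberOver f y.pt ≅ X)

variable {n X p}

/-- **Hodge-locus form.** `c` is absolutely rigid iff, for every good family `f`, every `e : 𝒳_t ≅ X`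
with `e^* c` a Hodge class on `𝒳_t`, the component of the HODGE LOCUS in `S(ℂ)` through `t`
determined by `e^* c` (`HodgeLocusComponent.base`, the image of the component of the locus of Hodge
classes) consists of points `s` with `𝒳_s ≅ X`. [cite: Voisin2007HodgeLoci, §1] -/
theorem isAbsolutelyRigidHodgeClass_iff_base_subset {c : complexBetti X (2 * p)} :
    IsAbsolutelyRigidHodgeClass n X p c ↔
      ∀ ⦃𝒳 S : Motives.SchemeOver ℂ⦄ (f : 𝒳 ⟶ S), GoodFamily n f →
        ∀ (t : Motives.ComplexPoints S) (e : Motives.fiberOver f t ≅ X)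
          (hx : (⟨t, complexBetti.map e.hom (2 * p) c⟩ : FiberClass f (2 * p)) ∈
            locusOfHodgeClasses f n p),
          (HodgeLocusComponent.of _ hx).base ⊆ {s | Nonempty (Motives.fiberOver f s ≅ X)} := by
  constructor
  · rintro h 𝒳 S f hf t e hx _ ⟨y, hy, rfl⟩
    exact h f hf t e hx y hy
  · intro h 𝒳 S f hf t e hx y hy
    exact h f hf t e hx ⟨y, hy, rfl⟩

/-- For an absolutely rigid class, **the Hodge locus of `(t, e^* c)`** (`hodgeLocusOfClass`, Voisin's
"Hodge locus of `α`") in any good family lies in the locus of fibres isomorphic to `X`.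
[cite: Voisin2007HodgeLoci, §1] -/
theorem IsAbsolutelyRigidHodgeClass.hodgeLocusOfClass_subset {c : complexBetti X (2 * p)}
    (h : IsAbsolutelyRigidHodgeClass n X p c) {𝒳 S : Motives.SchemeOver ℂ} {f : 𝒳 ⟶ S}
    (hf : GoodFamily n f) (t : Motives.ComplexPoints S) (e : Motives.fiberOver f t ≅ X)
    (hx : (⟨t, complexBetti.map e.hom (2 * p) c⟩ : FiberClass f (2 * p)) ∈
      locusOfHodgeClasses f n p) :
    hodgeLocusOfClass f n p ⟨t, complexBetti.map e.hom (2 * p) c⟩ ⊆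
      {s | Nonempty (Motives.fiberOver f s ≅ X)} := by
  rw [← HodgeLocusComponent.base_of hx]
  exact isAbsolutelyRigidHodgeClass_iff_base_subset.1 h f hf t e hx

/-- Elimination along the connected component itself: every fibre class in the connected component
of the locus of Hodge classes through `(t, e^* c)` lies over a fibre isomorphic to `X`.
[cite: Voisin2007HodgeLoci, §1] -/
theorem IsAbsolutelyRigidHodgeClass.nonempty_iso_of_mem_connectedComponentIn
    {c : complexBetti X (2 * p)} (h : IsAbsolutelyRigidHodgeClass n X p c)
    {𝒳 S : Motives.SchemeOver ℂ} {f : 𝒳 ⟶ S} (hf : GoodFamily n f) (t : Motives.ComplexPoints S)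
    (e : Motives.fiberOver f t ≅ X)
    (hx : (⟨t, complexBetti.map e.hom (2 * p) c⟩ : FiberClass f (2 * p)) ∈
      locusOfHodgeClasses f n p)
    {y : FiberClass f (2 * p)}
    (hy : y ∈ connectedComponentIn (locusOfHodgeClasses f n p) ⟨t, complexBetti.map e.hom (2 * p) c⟩) :
    Nonempty (Motives.fiberOver f y.pt ≅ X) :=
  h f hf t e hx y (by rwa [HodgeLocusComponent.carrier_of])

/-- **Negation, in the shape consumed by the variational trichotomy**: `c` is NOT absolutely rigid
iff some good family `f`, with an identification `e : 𝒳_t ≅ X` making `e^* c` a Hodge class on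
`𝒳_t`, moves `(t, e^* c)` inside its connected component of the locus of Hodge classes to a fibre
class over a fibre NOT isomorphic to `X` (the fibre varies along the Hodge locus of `e^* c`).
[cite: Voisin2007HodgeLoci, §1] -/
theorem not_isAbsolutelyRigidHodgeClass_iff {c : complexBetti X (2 * p)} :
    ¬ IsAbsolutelyRigidHodgeClass n X p c ↔
      ∃ (𝒳 S : Motives.SchemeOver ℂ) (f : 𝒳 ⟶ S), GoodFamily n f ∧
        ∃ (t : Motives.ComplexPoints S) (e : Motives.fiberOver f t ≅ X)
          (hx : (⟨t, complexBetti.map e.hom (2 * p) c⟩ : FiberClass f (2 * p)) ∈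
            locusOfHodgeClasses f n p),
          ∃ y ∈ (HodgeLocusComponent.of _ hx).carrier, IsEmpty (Motives.fiberOver f y.pt ≅ X) := by
  constructor
  · intro h
    by_contra hne
    refine h fun 𝒳 S f hf t e hx y hy ↦ ?_
    rw [← not_isEmpty_iff]
    exact fun hE ↦ hne ⟨𝒳, S, f, hf, t, e, hx, y, hy, hE⟩
  · rintro ⟨𝒳, S, f, hf, t, e, hx, y, hy, hE⟩ h
    exact (not_isEmpty_iff.2 (h f hf t e hx y hy)) hE

/-- **Degenerate case (boundary of the definition).** A class that is not rational is absolutely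
rigid VACUOUSLY: no pull-back `e^* c` along an isomorphism is rational
(`isRationalClass_map_iff_of_iso`), so the membership hypothesis `(t, e^* c) ∈ locusOfHodgeClasses`
is never met. Recorded to document that the predicate carries content only for Hodge classes.
[cite: HatcherAT2002, §3.1 p. 198] -/
theorem isAbsolutelyRigidHodgeClass_of_not_isRationalClass {c : complexBetti X (2 * p)}
    (hc : ¬ IsRationalClass c) : IsAbsolutelyRigidHodgeClass n X p c :=
  fun _ _ _ _ _ e hx ↦ absurd ((isRationalClass_map_iff_of_iso e).1 hx.1) hc

/-! ### Invariance under isomorphisms of the variety -/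

variable {X' : Motives.SchemeOver ℂ}

/-- **Transport along `e' : X' ≅ X`, one direction**: if `e'^* c` is absolutely rigid on `X'` then `c`
is absolutely rigid on `X` — an identification `e : 𝒳_t ≅ X` gives `e ≫ e'⁻¹ : 𝒳_t ≅ X'` with the
same fibre class, `(e ≫ e'⁻¹)^* (e'^* c) = e^* c`, hence the same component, and `𝒳_s ≅ X'` composes
with `e'` to `𝒳_s ≅ X`. [folklore] -/
theorem IsAbsolutelyRigidHodgeClass.of_map_iso (e' : X' ≅ X) {c : complexBetti X (2 * p)}
    (h : IsAbsolutelyRigidHodgeClass n X' p (complexBetti.map e'.hom (2 * p) c)) :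
    IsAbsolutelyRigidHodgeClass n X p c := by
  intro 𝒳 S f hf t e hx y hy
  have hcls : complexBetti.map (e ≪≫ e'.symm).hom (2 * p) (complexBetti.map e'.hom (2 * p) c) =
      complexBetti.map e.hom (2 * p) c := by
    rw [Iso.trans_hom, Iso.symm_hom, complexBetti.map_comp, CategoryTheory.comp_apply,
      e'.complexBetti_map_inv_map_hom]
  have hxeq : (⟨t, complexBetti.map (e ≪≫ e'.symm).hom (2 * p) (complexBetti.map e'.hom (2 * p) c)⟩ :
      FiberClass f (2 * p)) = ⟨t, complexBetti.map e.hom (2 * p) c⟩ := by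
    rw [hcls]
  have hx' : (⟨t, complexBetti.map (e ≪≫ e'.symm).hom (2 * p) (complexBetti.map e'.hom (2 * p) c)⟩ :
      FiberClass f (2 * p)) ∈ locusOfHodgeClasses f n p := hxeq ▸ hx
  have hy' : y ∈ (HodgeLocusComponent.of _ hx').carrier := by
    rwa [HodgeLocusComponent.of_congr hx' hx hxeq]
  obtain ⟨i⟩ := h f hf t (e ≪≫ e'.symm) hx' y hy'
  exact ⟨i ≪≫ e'⟩

/-- **Absolute rigidity is invariant under isomorphisms of the variety**: for `e' : X' ≅ X`, the
class `e'^* c` is absolutely rigid on `X'` iff `c` is on `X` (the backward direction is the forward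
one for `e'⁻¹`, as `(e'⁻¹)^* (e'^* c) = c`). [folklore] -/
theorem isAbsolutelyRigidHodgeClass_map_iff_of_iso (e' : X' ≅ X) {c : complexBetti X (2 * p)} :
    IsAbsolutelyRigidHodgeClass n X' p (complexBetti.map e'.hom (2 * p) c) ↔
      IsAbsolutelyRigidHodgeClass n X p c := by
  refine ⟨IsAbsolutelyRigidHodgeClass.of_map_iso e', fun h ↦ ?_⟩
  refine IsAbsolutelyRigidHodgeClass.of_map_iso e'.symm ?_
  rwa [Iso.symm_hom, e'.complexBetti_map_inv_map_hom]

end Rigid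

end HodgeTheory

end Literature.AlgebraicGeometry.HodgeTheory

end
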